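import Mathlib

/-!
# Imbrie (2016), assumption LLA — kernel-checked steps of the block Minami argument (audit cell, LLA.md gen-7 block O)

Companion to `TwoSpinHadamard.lean`.  Three groups of elementary facts used in LLA.md block O:

* the exact spectral-averaging constant of step O3 (S): `∫_ℝ β / ((s + α)² + β²) ds = π` for `β > 0`
  (the Krein-formula eigenvalue `μ = α − iβ` of `W` contributes exactly `π`, whence
  `∫ Tr(Π 1_{[a,b)}(H₀ + sΠ)) ds ≤ rank Π · (b − a)`);
* the three-spin landscape `f(σ) = c₀ + h₁σ₁ + h₂σ₂ + h₃σ₃ + J₁σ₁σ₂ + J₂σ₂σ₃` is orthogonal to the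
  character `σ₁σ₃` (O4(a) at n = 3): hence a landscape direction vanishing at 7 of the 8 configurations
  vanishes identically — every disorder direction has rank ≥ 2 = 2^{n−2}, the exact reach of one-variable
  interlacing on the three-spin block;
* the sector decomposition at frozen classical middle spin (O5(c)/(d)): in the sector σ₂ = s the landscape is
  `(c₀ + h₂ s) + (h₁ + J₁ s)σ₁ + (h₃ + J₂ s)σ₃` with NO σ₁σ₃ term (spins 1 and 3 structurally decoupled), and the
  cross-sector level differences move with slope exactly 2 in the spectator field.

All statements are def-free arithmetic / analysis facts; they neither prove nor disprove LLA.
[cite: ImbrieJSP2016, eq. (1.1), eq. (1.3)]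
-/

namespace Literature.MathematicalPhysics.QuantumLattice.Imbrie2016

open Real MeasureTheory

/-- [cite: ImbrieJSP2016, eq. (1.3)] the exact spectral-averaging constant (LLA.md O3 (S)):
`∫_ℝ β/((s+α)²+β²) ds = π` for every `α` and every `β > 0`. -/
theorem lorentzian_integral (α β : ℝ) (hβ : 0 < β) :
    ∫ s : ℝ, β / ((s + α) ^ 2 + β ^ 2) = π := by
  have hβ' : β ≠ 0 := hβ.ne'
  have h1 : ∀ s : ℝ, β / ((s + α) ^ 2 + β ^ 2)
      = (fun x : ℝ => β⁻¹ * (1 + x ^ 2)⁻¹) (β⁻¹ * (s + α)) := by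
    intro s
    have hden : (s + α) ^ 2 + β ^ 2 ≠ 0 := by positivity
    have hden' : 1 + (β⁻¹ * (s + α)) ^ 2 ≠ 0 := by positivity
    simp only
    field_simp
    ring
  simp_rw [h1]
  have h2 : ∫ s : ℝ, (fun x : ℝ => β⁻¹ * (1 + x ^ 2)⁻¹) (β⁻¹ * (s + α))
      = ∫ s : ℝ, (fun x : ℝ => β⁻¹ * (1 + x ^ 2)⁻¹) (β⁻¹ * s) :=
    integral_add_right_eq_self (μ := volume)
      (fun s : ℝ => (fun x : ℝ => β⁻¹ * (1 + x ^ 2)⁻¹) (β⁻¹ * s)) α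
  rw [h2, Measure.integral_comp_mul_left (fun x : ℝ => β⁻¹ * (1 + x ^ 2)⁻¹) β⁻¹]
  simp only [inv_inv, integral_const_mul, integral_univ_inv_one_add_sq, abs_of_pos hβ, smul_eq_mul]
  field_simp

/-- [cite: ImbrieJSP2016, eq. (1.1)] the three-spin landscape (shift adjoined) is orthogonal to the
character σ₁σ₃: `Σ_σ σ₁σ₃ f(σ) = 0` over the 8 configurations (LLA.md O4(a), n = 3). -/
theorem threeSpin_landscape_orthogonal_13 (c₀ h₁ h₂ h₃ J₁ J₂ : ℝ) :
    let f : ℝ → ℝ → ℝ → ℝ := fun s₁ s₂ s₃ =>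
      c₀ + h₁ * s₁ + h₂ * s₂ + h₃ * s₃ + J₁ * s₁ * s₂ + J₂ * s₂ * s₃
    (1 : ℝ) * 1 * f 1 1 1 + 1 * (-1) * f 1 1 (-1) + 1 * 1 * f 1 (-1) 1 + 1 * (-1) * f 1 (-1) (-1)
      + (-1) * 1 * f (-1) 1 1 + (-1) * (-1) * f (-1) 1 (-1) + (-1) * 1 * f (-1) (-1) 1
      + (-1) * (-1) * f (-1) (-1) (-1) = 0 := by
  simp only
  ring

/-- [cite: ImbrieJSP2016, eq. (1.1)] also orthogonal to the top character σ₁σ₂σ₃. -/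
theorem threeSpin_landscape_orthogonal_123 (c₀ h₁ h₂ h₃ J₁ J₂ : ℝ) :
    let f : ℝ → ℝ → ℝ → ℝ := fun s₁ s₂ s₃ =>
      c₀ + h₁ * s₁ + h₂ * s₂ + h₃ * s₃ + J₁ * s₁ * s₂ + J₂ * s₂ * s₃
    (1 : ℝ) * f 1 1 1 + (-1) * f 1 1 (-1) + (-1) * f 1 (-1) 1 + 1 * f 1 (-1) (-1)
      + (-1) * f (-1) 1 1 + 1 * f (-1) 1 (-1) + 1 * f (-1) (-1) 1 + (-1) * f (-1) (-1) (-1) = 0 := by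
  simp only
  ring

/-- [cite: ImbrieJSP2016, eq. (1.1)] minimal rank of a disorder direction on the three-spin block
(LLA.md O4(a), n = 3; one representative case, the others identical up to relabelling): inside the
sector σ₂ = +1 the landscape has no σ₁σ₃ component, so a landscape direction vanishing at the three
configurations (+,+,−), (−,+,+), (−,+,−) of that sector vanishes at (+,+,+) too.  Hence a non-zero
direction in span{1, σ_i, σ_iσ_{i+1}} meets every sector in 0 or ≥ 2 configurations, has rank ≥ 2 =
2^{n−2}, and one-variable interlacing moves the eigenvalue count by 2, never by 1. -/
theorem threeSpin_landscape_support (c₀ h₁ h₂ h₃ J₁ J₂ : ℝ)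
    (f : ℝ → ℝ → ℝ → ℝ)
    (hf : ∀ s₁ s₂ s₃, f s₁ s₂ s₃ = c₀ + h₁ * s₁ + h₂ * s₂ + h₃ * s₃ + J₁ * s₁ * s₂ + J₂ * s₂ * s₃)
    (h2 : f 1 1 (-1) = 0) (h5 : f (-1) 1 1 = 0) (h6 : f (-1) 1 (-1) = 0) : f 1 1 1 = 0 := by
  rw [hf] at h2 h5 h6 ⊢
  linarith

/-- [cite: ImbrieJSP2016, eq. (1.1)] and vanishing at six suitable configurations already forces the
whole direction to be zero (all six coefficients vanish): the evaluation map of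
span{1, σ₁, σ₂, σ₃, σ₁σ₂, σ₂σ₃} at {(+,+,−), (+,−,+), (+,−,−), (−,+,+), (−,+,−), (−,−,+)} is injective. -/
theorem threeSpin_landscape_coefficients_zero (c₀ h₁ h₂ h₃ J₁ J₂ : ℝ)
    (f : ℝ → ℝ → ℝ → ℝ)
    (hf : ∀ s₁ s₂ s₃, f s₁ s₂ s₃ = c₀ + h₁ * s₁ + h₂ * s₂ + h₃ * s₃ + J₁ * s₁ * s₂ + J₂ * s₂ * s₃)
    (h2 : f 1 1 (-1) = 0) (h3 : f 1 (-1) 1 = 0) (h4 : f 1 (-1) (-1) = 0)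
    (h5 : f (-1) 1 1 = 0) (h6 : f (-1) 1 (-1) = 0) (h7 : f (-1) (-1) 1 = 0) :
    c₀ = 0 ∧ h₁ = 0 ∧ h₂ = 0 ∧ h₃ = 0 ∧ J₁ = 0 ∧ J₂ = 0 := by
  rw [hf] at h2 h3 h4 h5 h6 h7
  refine ⟨?_, ?_, ?_, ?_, ?_, ?_⟩ <;> linarith

/-- [cite: ImbrieJSP2016, eq. (1.1)] sector decomposition at frozen middle spin (LLA.md O5(c)):
in the sector σ₂ = s (s = ±1) the landscape is an effective TWO-spin landscape in (σ₁, σ₃) with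
effective shift c₀ + h₂ s, effective fields h₁ + J₁ s and h₃ + J₂ s, and no σ₁σ₃ coupling. -/
theorem threeSpin_sector_landscape (c₀ h₁ h₂ h₃ J₁ J₂ s s₁ s₃ : ℝ) :
    c₀ + h₁ * s₁ + h₂ * s + h₃ * s₃ + J₁ * s₁ * s + J₂ * s * s₃
      = (c₀ + h₂ * s) + (h₁ + J₁ * s) * s₁ + (h₃ + J₂ * s) * s₃ := by
  ring

/-- [cite: ImbrieJSP2016, eq. (1.1)] the sector parameters are a bijective image of the couplings:
(c₀,h₂) ↦ (c₊,c₋), (h₁,J₁) ↦ (x₊,x₋), (h₃,J₂) ↦ (y₊,y₋) are 2×2 Hadamard maps (inverse shown). -/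
theorem threeSpin_sector_parameters_inverse (h J : ℝ) :
    h = ((h + J * 1) + (h + J * (-1))) / 2 ∧ J = ((h + J * 1) - (h + J * (-1))) / 2 := by
  constructor <;> ring

/-- [cite: ImbrieJSP2016, eq. (1.3)] cross-sector level differences at a conserved end spin
(LLA.md O5(d), slice t₃ = 0): if `E⁺ = E₀⁺ + h` and `E⁻ = E₀⁻ − h` with `E₀^±` independent of the
spectator field `h`, the difference has slope exactly 2 in `h`, so `{h : |E⁺ − E⁻| < η}` is an
interval of length `η`. -/
theorem crossSector_difference_slope_two (E₀p E₀m h : ℝ) :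
    (E₀p + h) - (E₀m - h) = (E₀p - E₀m) + 2 * h := by ring

/-- [cite: ImbrieJSP2016, eq. (1.3)] … quantitatively: the set of `h` with `|d + 2h| < η` lies in an
interval of length `η` (centre `−d/2`). -/
theorem crossSector_window (d h η : ℝ) (hh : |d + 2 * h| < η) :
    -d / 2 - η / 2 < h ∧ h < -d / 2 + η / 2 := by
  rcases abs_lt.mp hh with ⟨h1, h2⟩
  constructor <;> linarith

/-- [cite: ImbrieJSP2016, p. 1000] density constants of the ln-counterexample (LLA.md O5(c)):
for `M ≥ 1` and `|u| ≤ 1`, the density `(8M − 2|u|)/(32M²)` of the half-difference of two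
independent `U[−4M,4M]` variables is at least `3/(16M)`. -/
theorem halfDifference_density_lower (M u : ℝ) (hM : 1 ≤ M) (hu : |u| ≤ 1) :
    3 / (16 * M) ≤ (8 * M - 2 * |u|) / (32 * M ^ 2) := by
  have hMpos : 0 < M := by linarith
  rw [div_le_div_iff₀ (by positivity) (by positivity)]
  nlinarith [abs_nonneg u]

/-- [cite: ImbrieJSP2016, p. 1000] … and for `|v| ≤ 1 ≤ M` the density `(2M − |v|)/(4M²)` of the sum
of two independent `U[−M,M]` variables is at least `1/(4M)`; the product is ≥ 3/(64M²). -/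
theorem sum_density_lower (M v : ℝ) (hM : 1 ≤ M) (hv : |v| ≤ 1) :
    1 / (4 * M) ≤ (2 * M - |v|) / (4 * M ^ 2) := by
  have hMpos : 0 < M := by linarith
  rw [div_le_div_iff₀ (by positivity) (by positivity)]
  nlinarith [abs_nonneg v]

/-- [cite: ImbrieJSP2016, p. 1000] the product of the two lower bounds. -/
theorem lnCounterexample_joint_density (M : ℝ) (hM : 1 ≤ M) :
    3 / (16 * M) * (1 / (4 * M)) = 3 / (64 * M ^ 2) := by
  have hMpos : 0 < M := by linarith
  field_simp
  ring

end Literature.MathematicalPhysics.QuantumLattice.Imbrie2016
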